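import Summits.ValiantsHypothesis.ValiantsHypothesis.Theorems.LacunarySymmetroidMatrixDescartesCensusDefs

/-!
# `MatrixDescartes` census — DOOR A at `(3,4)`: NESTED POSITIVE CONES FORCE A COMMON KERNEL (the crosses of two middle-type roots)

HONEST FRAMING.  Object-search cell `pub-symmetroid`, door-A seat `val-sym-door-p3` (g23); a STRUCTURE row `--supports` the route
item `Theses.LacunarySymmetroid.DoorA34` (stmt-ValiantsHypothesis-19980, `DoorA34 = PosRootLawAt 3 4 18`), OPEN and asserted nowhere
here.  Every many-root object of record at `(3,4)` is an ALL-MIDDLE walk (lift-p / eng seats): at each det-root `r` the matrix `M(r)` is a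
rank-two INDEFINITE form, `M(r) = b·f₃f₃ᵀ − a·f₁f₁ᵀ` (`a, b > 0`, kernel line `ℝ·(f₁ × f₃)`), whose positive cone `{u : uᵀM(r)u > 0}` is
a double wedge of `ℝP²` with vertex the kernel line (a «cross»).  For a fixed direction `u` the Rayleigh `4`-nomial `uᵀM(x)u` changes sign
between two roots `r < r'` exactly when `u` lies in one positive cone and not in the other, and it has `≤ 3` positive roots in all; so the
door's all-middle regime is governed by how the `19` crosses can sit relative to each other.  This file proves the basic rigidity:

* `nonneg_of_forall_add_sq_mul_nonneg` — the limit trick `(∀ t ≠ 0, 0 ≤ A + t²B) ⇒ 0 ≤ A`;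
* `quadForm_add_smul_kernel`, `quadForm_add_smul` — expansions of `uᵀΦu` along a kernel vector / a general vector (Φ symmetric);
* **`kernel_orthogonal_of_nested_posCone`** — if `Φ` is a real symmetric `3 × 3` matrix with a kernel vector `k` and SOME positive
  direction, and its positive cone is contained in the positive cone of the cross `ψ(u) = b·(f₃·u)² − a·(f₁·u)²` (`a > 0`, `f₁ ∉ ℝf₃`
  witnessed by a `v` with `f₃·v = 0 ≠ f₁·v`), then `f₁·k = 0` and `f₃·k = 0`: the kernel vector of `Φ` spans the vertex line of the cross.
  READING: the positive cones at two middle-type roots with DIFFERENT kernel lines are never nested — in either order there is an open set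
  of directions `u` whose Rayleigh `4`-nomial changes sign between the two roots (and `≤ 3` roots share a kernel line, `…KernelLines`).

Nothing here bounds `ζ_sym(3,4)`; `DoorA34` and `MatrixDescartes` (stmt-ValiantsHypothesis-18050) stay OPEN; nothing on `VP ≠ VNP`.
[folklore] Elementary real linear algebra (a double wedge contains no double wedge with another vertex).
-/

-- `Summit.ValiantsHypothesis.ValiantsHypothesis.…` repeats a component by the D-0017 layout
-- (single-conjunct summit), which the `dupNamespace` linter flags; the name is mandated.
set_option linter.dupNamespace false

namespace Summit.ValiantsHypothesis.ValiantsHypothesis.Theorems.LacunarySymmetroidMatrixDescartes.Census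

open Matrix Finset
open scoped BigOperators Matrix

namespace NestedCones

/-- The limit trick: if `A + t²·B ≥ 0` for every `t ≠ 0` then `A ≥ 0`. [folklore] -/
theorem nonneg_of_forall_add_sq_mul_nonneg (A B : ℝ) (h : ∀ t : ℝ, t ≠ 0 → 0 ≤ A + t ^ 2 * B) : 0 ≤ A := by
  by_contra hA
  push Not at hA
  by_cases hB : B ≤ 0
  · have := h 1 one_ne_zero
    linarith
  · push Not at hB
    set s : ℝ := -A / (2 * B) with hs
    have hs0 : 0 < s := by rw [hs]; exact div_pos (by linarith) (by linarith)
    set t : ℝ := Real.sqrt s with ht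
    have ht0 : t ≠ 0 := by rw [ht]; exact (Real.sqrt_pos.mpr hs0).ne'
    have ht2 : t ^ 2 = s := by rw [ht, Real.sq_sqrt hs0.le]
    have := h t ht0
    rw [ht2, hs] at this
    have e : A + -A / (2 * B) * B = A / 2 := by field_simp; ring
    rw [e] at this
    linarith

/-- Symmetric matrices: `k ⬝ (Φ w) = w ⬝ (Φ k)`. [folklore] -/
theorem dotProduct_mulVec_comm_of_isSymm {Φ : Matrix (Fin 3) (Fin 3) ℝ} (hΦ : Φ.IsSymm) (k w : Fin 3 → ℝ) :
    k ⬝ᵥ (Φ *ᵥ w) = w ⬝ᵥ (Φ *ᵥ k) := by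
  have h1 : k ⬝ᵥ (Φ *ᵥ w) = (k ᵥ* Φ) ⬝ᵥ w := (Matrix.dotProduct_mulVec k Φ w)
  rw [h1, ← Matrix.mulVec_transpose, hΦ.eq, dotProduct_comm]

/-- Expansion along a kernel vector: `(w + c·k)ᵀΦ(w + c·k) = wᵀΦw` when `Φk = 0`, `Φ` symmetric. [folklore] -/
theorem quadForm_add_smul_kernel {Φ : Matrix (Fin 3) (Fin 3) ℝ} (hΦ : Φ.IsSymm) {k : Fin 3 → ℝ} (hk : Φ *ᵥ k = 0)
    (w : Fin 3 → ℝ) (c : ℝ) :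
    (w + c • k) ⬝ᵥ (Φ *ᵥ (w + c • k)) = w ⬝ᵥ (Φ *ᵥ w) := by
  have hkw : k ⬝ᵥ (Φ *ᵥ w) = 0 := by rw [dotProduct_mulVec_comm_of_isSymm hΦ, hk, dotProduct_zero]
  rw [Matrix.mulVec_add, Matrix.mulVec_smul, hk, smul_zero, add_zero, add_dotProduct, smul_dotProduct, hkw, smul_eq_mul,
    mul_zero, add_zero]

/-- Expansion along a general vector: `(u + t·v)ᵀΦ(u + t·v) = uᵀΦu + 2t·uᵀΦv + t²·vᵀΦv`, `Φ` symmetric. [folklore] -/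
theorem quadForm_add_smul {Φ : Matrix (Fin 3) (Fin 3) ℝ} (hΦ : Φ.IsSymm) (u v : Fin 3 → ℝ) (t : ℝ) :
    (u + t • v) ⬝ᵥ (Φ *ᵥ (u + t • v)) = u ⬝ᵥ (Φ *ᵥ u) + 2 * t * (u ⬝ᵥ (Φ *ᵥ v)) + t ^ 2 * (v ⬝ᵥ (Φ *ᵥ v)) := by
  have hvu : v ⬝ᵥ (Φ *ᵥ u) = u ⬝ᵥ (Φ *ᵥ v) := dotProduct_mulVec_comm_of_isSymm hΦ v u
  simp only [Matrix.mulVec_add, Matrix.mulVec_smul, add_dotProduct, dotProduct_add, smul_dotProduct, dotProduct_smul,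
    smul_eq_mul, hvu]
  ring

/-- **NESTED POSITIVE CONES FORCE A COMMON KERNEL.**  Let `Φ` be a real symmetric `3 × 3` matrix with `Φk = 0` and some direction `w₀`
with `w₀ᵀΦw₀ > 0`.  Let `ψ(u) = b·(f₃·u)² − a·(f₁·u)²` with `a > 0` (any real `b`), and let `v` witness `f₃·v = 0`, `f₁·v ≠ 0`.  If the positive cone
of `Φ` lies in the positive cone of `ψ` — `uᵀΦu > 0 ⇒ ψ(u) > 0` for all `u` — then `f₁·k = 0` and `f₃·k = 0` (the kernel vector of `Φ`
lies on the vertex line `f₁^⊥ ∩ f₃^⊥` of the cross `ψ`). [folklore] -/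
theorem kernel_orthogonal_of_nested_posCone (Φ : Matrix (Fin 3) (Fin 3) ℝ) (hΦ : Φ.IsSymm) (k : Fin 3 → ℝ) (hk : Φ *ᵥ k = 0)
    (w₀ : Fin 3 → ℝ) (hw₀ : 0 < w₀ ⬝ᵥ (Φ *ᵥ w₀))
    (a b : ℝ) (ha : 0 < a) (f₁ f₃ v : Fin 3 → ℝ) (hv₃ : f₃ ⬝ᵥ v = 0) (hv₁ : f₁ ⬝ᵥ v ≠ 0)
    (hnest : ∀ u : Fin 3 → ℝ, 0 < u ⬝ᵥ (Φ *ᵥ u) → 0 < b * (f₃ ⬝ᵥ u) ^ 2 - a * (f₁ ⬝ᵥ u) ^ 2) :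
    f₁ ⬝ᵥ k = 0 ∧ f₃ ⬝ᵥ k = 0 := by
  -- (i) `ψ(k) ≥ 0`: the points `k + t w₀` lie in the positive cone of `Φ`
  have hψk : 0 ≤ b * (f₃ ⬝ᵥ k) ^ 2 - a * (f₁ ⬝ᵥ k) ^ 2 := by
    apply nonneg_of_forall_add_sq_mul_nonneg _ (b * (f₃ ⬝ᵥ w₀) ^ 2 - a * (f₁ ⬝ᵥ w₀) ^ 2)
    intro t ht
    have hpos : ∀ s : ℝ, s ≠ 0 → 0 < b * (f₃ ⬝ᵥ (k + s • w₀)) ^ 2 - a * (f₁ ⬝ᵥ (k + s • w₀)) ^ 2 := by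
      intro s hs
      apply hnest
      have : (k + s • w₀) ⬝ᵥ (Φ *ᵥ (k + s • w₀)) = s ^ 2 * (w₀ ⬝ᵥ (Φ *ᵥ w₀)) := by
        have h1 := quadForm_add_smul_kernel hΦ hk (s • w₀) 1
        rw [one_smul, add_comm] at h1
        rw [h1, Matrix.mulVec_smul, smul_dotProduct, dotProduct_smul, smul_eq_mul, smul_eq_mul]
        ring
      rw [this]
      exact mul_pos (by positivity) hw₀
    have h1 := hpos t ht
    have h2 := hpos (-t) (neg_ne_zero.mpr ht)
    simp only [dotProduct_add, dotProduct_smul, smul_eq_mul] at h1 h2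
    nlinarith [h1, h2]
  -- (ii) on the plane `f₃·u = 0`, `Φ ≤ 0`: first where `f₁·u ≠ 0` (there `ψ < 0`), then everywhere by the limit trick along `v`
  have hneg1 : ∀ u : Fin 3 → ℝ, f₃ ⬝ᵥ u = 0 → f₁ ⬝ᵥ u ≠ 0 → u ⬝ᵥ (Φ *ᵥ u) ≤ 0 := by
    intro u hu3 hu1
    by_contra hpos
    push Not at hpos
    have := hnest u hpos
    rw [hu3] at this
    have : 0 < (f₁ ⬝ᵥ u) ^ 2 := by positivity
    nlinarith
  have hvneg : v ⬝ᵥ (Φ *ᵥ v) ≤ 0 := hneg1 v hv₃ hv₁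
  have hnegW : ∀ u : Fin 3 → ℝ, f₃ ⬝ᵥ u = 0 → u ⬝ᵥ (Φ *ᵥ u) ≤ 0 := by
    intro u hu3
    by_cases hu1 : f₁ ⬝ᵥ u ≠ 0
    · exact hneg1 u hu3 hu1
    · push Not at hu1
      -- `u + t v` lies in the plane and has `f₁`-component `t·(f₁·v) ≠ 0`
      have hline : ∀ t : ℝ, t ≠ 0 → (u + t • v) ⬝ᵥ (Φ *ᵥ (u + t • v)) ≤ 0 := by
        intro t ht
        apply hneg1
        · rw [dotProduct_add, dotProduct_smul, hu3, hv₃, smul_zero, add_zero]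
        · rw [dotProduct_add, dotProduct_smul, hu1, zero_add, smul_eq_mul]
          exact mul_ne_zero ht hv₁
      have key : 0 ≤ -(u ⬝ᵥ (Φ *ᵥ u)) := by
        apply nonneg_of_forall_add_sq_mul_nonneg _ (-(v ⬝ᵥ (Φ *ᵥ v)))
        intro t ht
        have h1 := hline t ht
        have h2 := hline (-t) (neg_ne_zero.mpr ht)
        rw [quadForm_add_smul hΦ] at h1 h2
        nlinarith [h1, h2]
      linarith
  -- (iii) `f₃·k = 0`: otherwise every `u` is `w + c k` with `f₃·w = 0`, and `Φ ≤ 0` everywhere, contradicting `w₀`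
  have hk3 : f₃ ⬝ᵥ k = 0 := by
    by_contra hk3
    set c : ℝ := (f₃ ⬝ᵥ w₀) / (f₃ ⬝ᵥ k) with hc
    set w : Fin 3 → ℝ := w₀ - c • k with hw
    have hw3 : f₃ ⬝ᵥ w = 0 := by
      rw [hw, dotProduct_sub, dotProduct_smul, smul_eq_mul, hc, div_mul_cancel₀ _ hk3, sub_self]
    have hdecomp : w₀ = w + c • k := by rw [hw]; abel
    have h1 : w₀ ⬝ᵥ (Φ *ᵥ w₀) = w ⬝ᵥ (Φ *ᵥ w) := by rw [hdecomp]; exact quadForm_add_smul_kernel hΦ hk w c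
    have h2 := hnegW w hw3
    linarith
  -- (iv) then `ψ(k) = −a (f₁·k)² ≥ 0` forces `f₁·k = 0`
  refine ⟨?_, hk3⟩
  rw [hk3] at hψk
  have hsq : (f₁ ⬝ᵥ k) ^ 2 ≤ 0 := by nlinarith
  exact pow_eq_zero_iff (two_ne_zero) |>.mp (le_antisymm hsq (sq_nonneg _))

/-- **Corollary (no nesting in the other order either, symmetric form).**  Two crosses `ψᵢ(u) = bᵢ(f₃⁽ⁱ⁾·u)² − aᵢ(f₁⁽ⁱ⁾·u)²` realised as
symmetric matrices `Φ₁, Φ₂` (`uᵀΦᵢu = ψᵢ(u)`), each with a kernel vector `kᵢ` off the other's vertex line, are never nested: there is a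
direction `u` with `uᵀΦ₁u > 0 ≥ … `, precisely `¬ (∀ u, 0 < uᵀΦ₁u → 0 < uᵀΦ₂u)`. [folklore] -/
theorem not_nested_of_kernel_off_vertex (Φ₁ : Matrix (Fin 3) (Fin 3) ℝ) (hΦ₁ : Φ₁.IsSymm) (k₁ : Fin 3 → ℝ) (hk₁ : Φ₁ *ᵥ k₁ = 0)
    (w₀ : Fin 3 → ℝ) (hw₀ : 0 < w₀ ⬝ᵥ (Φ₁ *ᵥ w₀))
    (a b : ℝ) (ha : 0 < a) (f₁ f₃ v : Fin 3 → ℝ) (hv₃ : f₃ ⬝ᵥ v = 0) (hv₁ : f₁ ⬝ᵥ v ≠ 0)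
    (hoff : f₁ ⬝ᵥ k₁ ≠ 0 ∨ f₃ ⬝ᵥ k₁ ≠ 0) :
    ¬ (∀ u : Fin 3 → ℝ, 0 < u ⬝ᵥ (Φ₁ *ᵥ u) → 0 < b * (f₃ ⬝ᵥ u) ^ 2 - a * (f₁ ⬝ᵥ u) ^ 2) := by
  intro hnest
  obtain ⟨h1, h3⟩ := kernel_orthogonal_of_nested_posCone Φ₁ hΦ₁ k₁ hk₁ w₀ hw₀ a b ha f₁ f₃ v hv₃ hv₁ hnest
  rcases hoff with h | h
  · exact h h1
  · exact h h3

/-! ## Coordinate-free form: two symmetric matrices with kernel vectors (no eigen-decomposition needed) -/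

/-- Columns `k', u, k`: the vector `c₀·k' + c₁·u + c₂·k` is the matrix–vector product with the transposed row matrix. [folklore] -/
theorem transpose_rows_mulVec (k' u k c : Fin 3 → ℝ) :
    (Matrix.of ![k', u, k])ᵀ *ᵥ c = c 0 • k' + c 1 • u + c 2 • k := by
  ext j
  simp [Matrix.mulVec, dotProduct, Fin.sum_univ_three, Matrix.transpose_apply, mul_comm]

/-- **NESTED POSITIVE CONES FORCE A COMMON KERNEL — coordinate-free form.**  Let `Φ, Ψ` be real symmetric `3 × 3` matrices with kernel
vectors `Φk = 0`, `Ψk' = 0`, `k' ≠ 0`; suppose `Φ` has a positive direction (`w₀ᵀΦw₀ > 0`) and `Ψ` a negative one (`umᵀΨum < 0`).  If the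
positive cone of `Φ` lies in the positive cone of `Ψ` (`uᵀΦu > 0 ⇒ uᵀΨu > 0`), then `k` is a multiple of `k'`.  At two middle-type det-roots
`r, r'` of a symmetric pencil (`M(r)`, `M(r')` indefinite of rank two) these hypotheses hold with `Φ = M(r)`, `Ψ = M(r')`, so NESTED positive
cones force a COMMON kernel line — which at most three roots can share (`…KernelLines`). [folklore] -/
theorem kernel_parallel_of_nested_posCone (Φ Ψ : Matrix (Fin 3) (Fin 3) ℝ) (hΦ : Φ.IsSymm) (hΨ : Ψ.IsSymm)
    (k k' : Fin 3 → ℝ) (hk : Φ *ᵥ k = 0) (hk' : Ψ *ᵥ k' = 0) (hk'0 : k' ≠ 0)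
    (w₀ : Fin 3 → ℝ) (hw₀ : 0 < w₀ ⬝ᵥ (Φ *ᵥ w₀)) (um : Fin 3 → ℝ) (hum : um ⬝ᵥ (Ψ *ᵥ um) < 0)
    (hnest : ∀ u : Fin 3 → ℝ, 0 < u ⬝ᵥ (Φ *ᵥ u) → 0 < u ⬝ᵥ (Ψ *ᵥ u)) :
    ∃ α : ℝ, k = α • k' := by
  -- (i) `Ψ(k) ≥ 0`
  have hΨk : 0 ≤ k ⬝ᵥ (Ψ *ᵥ k) := by
    apply nonneg_of_forall_add_sq_mul_nonneg _ (w₀ ⬝ᵥ (Ψ *ᵥ w₀))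
    intro t ht
    have hpos : ∀ s : ℝ, s ≠ 0 → 0 < (k + s • w₀) ⬝ᵥ (Ψ *ᵥ (k + s • w₀)) := by
      intro s hs
      apply hnest
      have h1 := quadForm_add_smul_kernel hΦ hk (s • w₀) 1
      rw [one_smul, add_comm] at h1
      rw [h1, Matrix.mulVec_smul, smul_dotProduct, dotProduct_smul, smul_eq_mul, smul_eq_mul]
      have : s * (s * (w₀ ⬝ᵥ (Φ *ᵥ w₀))) = s ^ 2 * (w₀ ⬝ᵥ (Φ *ᵥ w₀)) := by ring
      rw [this]
      exact mul_pos (by positivity) hw₀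
    have h1 := hpos t ht
    have h2 := hpos (-t) (neg_ne_zero.mpr ht)
    rw [quadForm_add_smul hΨ] at h1 h2
    nlinarith [h1, h2]
  -- (ii) `Φ ≤ 0` on the plane spanned by `k'` and `um`
  have hΨplane : ∀ α β : ℝ, (α • k' + β • um) ⬝ᵥ (Ψ *ᵥ (α • k' + β • um)) = β ^ 2 * (um ⬝ᵥ (Ψ *ᵥ um)) := by
    intro α β
    have h1 := quadForm_add_smul_kernel hΨ hk' (β • um) α
    rw [add_comm] at h1
    rw [h1, Matrix.mulVec_smul, smul_dotProduct, dotProduct_smul, smul_eq_mul, smul_eq_mul]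
    ring
  have hneg1 : ∀ α β : ℝ, β ≠ 0 → (α • k' + β • um) ⬝ᵥ (Φ *ᵥ (α • k' + β • um)) ≤ 0 := by
    intro α β hβ
    by_contra hpos
    push Not at hpos
    have h := hnest _ hpos
    rw [hΨplane] at h
    have : 0 < β ^ 2 := by positivity
    nlinarith
  have hnegW : ∀ α β : ℝ, (α • k' + β • um) ⬝ᵥ (Φ *ᵥ (α • k' + β • um)) ≤ 0 := by
    intro α β
    by_cases hβ : β ≠ 0
    · exact hneg1 α β hβ
    · push Not at hβ
      subst hβ
      have hline : ∀ t : ℝ, t ≠ 0 → (α • k' + (0 : ℝ) • um + t • um) ⬝ᵥ (Φ *ᵥ (α • k' + (0 : ℝ) • um + t • um)) ≤ 0 := by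
        intro t ht
        have e : α • k' + (0 : ℝ) • um + t • um = α • k' + t • um := by rw [zero_smul, add_zero]
        rw [e]
        exact hneg1 α t ht
      have key : 0 ≤ -((α • k' + (0 : ℝ) • um) ⬝ᵥ (Φ *ᵥ (α • k' + (0 : ℝ) • um))) := by
        apply nonneg_of_forall_add_sq_mul_nonneg _ (-(um ⬝ᵥ (Φ *ᵥ um)))
        intro t ht
        have h1 := hline t ht
        have h2 := hline (-t) (neg_ne_zero.mpr ht)
        rw [quadForm_add_smul hΦ] at h1 h2
        nlinarith [h1, h2]
      linarith
  -- (iii) `k`, `k'`, `um` are linearly dependent: otherwise every vector is `a k' + b um + c k` and `Φ ≤ 0` everywhere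
  set R : Matrix (Fin 3) (Fin 3) ℝ := (Matrix.of ![k', um, k])ᵀ with hR
  have hdet : R.det = 0 := by
    by_contra hdet
    have hunit : IsUnit R.det := isUnit_iff_ne_zero.mpr hdet
    set c : Fin 3 → ℝ := R⁻¹ *ᵥ w₀ with hc
    have hw : w₀ = c 0 • k' + c 1 • um + c 2 • k := by
      rw [← transpose_rows_mulVec, ← hR, hc, Matrix.mulVec_mulVec, Matrix.mul_nonsing_inv _ hunit, Matrix.one_mulVec]
    have h1 : w₀ ⬝ᵥ (Φ *ᵥ w₀) = (c 0 • k' + c 1 • um) ⬝ᵥ (Φ *ᵥ (c 0 • k' + c 1 • um)) := by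
      rw [hw]
      exact quadForm_add_smul_kernel hΦ hk _ _
    have h2 := hnegW (c 0) (c 1)
    linarith
  obtain ⟨c, hc0, hc⟩ := Matrix.exists_mulVec_eq_zero_iff.mpr hdet
  rw [hR, transpose_rows_mulVec] at hc
  -- `c 2 ≠ 0`: otherwise `c 0 k' + c 1 um = 0` with `(c 0, c 1) ≠ 0`, impossible as `Ψ(um) < 0 = Ψ` on `ℝk'`
  have hc2 : c 2 ≠ 0 := by
    intro h2
    rw [h2, zero_smul, add_zero] at hc
    by_cases h1 : c 1 = 0
    · rw [h1, zero_smul, add_zero] at hc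
      have h0 : c 0 = 0 := by
        by_contra h0
        exact hk'0 ((smul_eq_zero.mp hc).resolve_left h0)
      apply hc0
      ext i
      fin_cases i
      · exact h0
      · exact h1
      · exact h2
    · have hΨ0 := hΨplane (c 0) (c 1)
      rw [hc, Matrix.mulVec_zero, dotProduct_zero] at hΨ0
      have : 0 < (c 1) ^ 2 := by positivity
      nlinarith
  -- so `k = α k' + β um`, and (i) with `Ψ(um) < 0` forces `β = 0`
  set α : ℝ := -(c 0) / c 2 with hα
  set β : ℝ := -(c 1) / c 2 with hβ
  have hkeq : k = α • k' + β • um := by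
    have e : k = (-(1 : ℝ) / c 2) • (c 0 • k' + c 1 • um) := by
      have h3 : c 2 • k = -(c 0 • k' + c 1 • um) := by rw [eq_neg_iff_add_eq_zero, add_comm]; exact hc
      have h4 : k = (c 2)⁻¹ • (c 2 • k) := by rw [smul_smul, inv_mul_cancel₀ hc2, one_smul]
      rw [h4, h3, smul_neg, neg_div, neg_smul, one_div]
    rw [e, smul_add, smul_smul, smul_smul, hα, hβ]
    congr 1 <;> congr 1 <;> ring
  have hΨk' := hΨk
  rw [hkeq, hΨplane] at hΨk'
  have hβ0 : β = 0 := by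
    by_contra hβ0
    have : 0 < β ^ 2 := by positivity
    nlinarith
  refine ⟨α, ?_⟩
  rw [hkeq, hβ0, zero_smul, add_zero]

end NestedCones

end Summit.ValiantsHypothesis.ValiantsHypothesis.Theorems.LacunarySymmetroidMatrixDescartes.Census
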